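import Summits.MatrixMultiplication.OmegaCensus.STPPRepresentationCountNonabelian

/-!
# ω-census: one-sided near-periods in any group and the abstract density bound `5m ≤ 2|G| + 8` (Kneser-free)

HONEST FRAMING (pub-omega census; verbatim): lottery ticket; floor = certified bounds/negative ranges.
Census STRUCTURE (seat pub-omega-stpp-1 gen 26, 2026-08-27), family (b2), STRUCTURE question Q7.  Nothing here is progress
on `ω`: abstract multiplicative combinatorics used by `STPP222DensityTenAnyGroup.lean` to EXCLUDE simultaneous-TPP families.

## Contents

Abstract setting: `X, Y, Z ⊆ G` (any group) of size `m`, every `z ∈ Z` with exactly two factorisations `z = x·y`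
(`repMul X Y z = 2`, tree `STPPRepresentationCountNonabelian.lean`), every right translate `X·y` (`y ∈ Y`) and every left
translate `x·Y` (`x ∈ X`) meeting `Z` in at most two points; `n = |G|`, `σ := 3m − n − 4`.
* §1 the one-sided counts `difR X δ = |X ∩ X·δ|`, `difL Y g = |Y ∩ g·Y|`, their double counting `Σ_δ difR X δ = #X²`, and
  `Σ_g repMul X Y g = #X·#Y`;
* §2 NEAR-PERIODS by inclusion–exclusion of two translates inside `G ∖ Z`: `difR X (y'y⁻¹) ≥ σ` (`le_difR_of_translate`),
  `difL Y (x⁻¹x') ≥ σ` (`le_difL_of_translate`); CLOSURE BY PIGEONHOLE (`difR_mul_pos_of_lt`: two subsets of `X` of size `> m/2`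
  meet, so `|X ∩ Xδ| > m/2` on `X⁻¹X` makes `X⁻¹X` closed under products — the device behind Freiman's `3/2`-theorem); and the
  bound `five_mul_le_two_mul_card_add_group`: **`5m ≤ 2|G| + 8` once `m ≥ 4`**.  Proof: if `2σ > m` then `σ ≥ 1`, a near-period
  is a genuine quotient, `D := X⁻¹X = YY⁻¹` consists of near-periods, `D·D ⊆ D`, so `X·Y ⊆ x₀·D·y₀` — `#D` points containing `Z`
  and absorbing all `m²` products, whence `#D ≥ 2m − 2`; the energy `Σ_{δ ∈ D} difR X δ ≤ m²` minus `δ = 1` gives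
  `(#D − 1)σ ≤ m² − m`, i.e. `m ≤ 3`.  No commutativity, no Kneser, no stabilizers (the abelian file `STPP222DensityTen.lean`
  used Kneser; under `2σ > m` its open branch is vacuous).

LIMIT OF THE METHOD (recorded, not a theorem): the abstract hypotheses alone cannot give much more — abstract configurations
with `σ ≥ 1` exist, e.g. `X = Y = {0,1,2,5,7}`, `Z = {0,1,4,6,9}` in `ℤ/10` (`m = 5`, `n = 2m`, `σ = 1`), and with `n = 2m` also for
`m = 6` (`ℤ/12`) and `m = 7` (`ℤ₂ × ℤ₈`) (seat's exhaustive search, HOME `pub-omega-stpp-1-g26/code/abstract_sigma.py`, numbers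
only); sharper laws must use the block structure of CKSU Def. 5.1.

References: H. Cohn, R. Kleinberg, B. Szegedy, C. Umans, FOCS 2005 (arXiv:math/0511460), Def. 5.1 (the customer); the closure
device is the pigeonhole behind Freiman's `3/2`-theorem, cf. T. Tao, "An elementary non-commutative Freiman theorem" (blog,
2009-11-10) and Mathlib's `Mathlib.Combinatorics.Additive.VerySmallDoubling`; proved here from scratch (folklore).
-/

open Finset

namespace Summit.MatrixMultiplication.OmegaCensus.CubeNB

variable {G : Type*} [Group G] [DecidableEq G]


/-! ## §1 Left/right near-period counts and their double counting -/

/-- Right near-period count: `difR X δ = #{x ∈ X : x·δ⁻¹ ∈ X} = |X ∩ X·δ|` (the number of factorisations `δ = x'⁻¹x`,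
`x, x' ∈ X`). [folklore] -/
def difR (X : Finset G) (δ : G) : ℕ := #(X.filter fun x => x * δ⁻¹ ∈ X)

/-- Left near-period count: `difL Y g = #{y ∈ Y : g⁻¹·y ∈ Y} = |Y ∩ g·Y|`. [folklore] -/
def difL (Y : Finset G) (g : G) : ℕ := #(Y.filter fun y => g⁻¹ * y ∈ Y)

/-- `difR X δ ≤ #X`. [folklore] -/
theorem difR_le (X : Finset G) (δ : G) : difR X δ ≤ #X := card_filter_le _ _

/-- `difR X 1 = #X`. [folklore] -/
theorem difR_one (X : Finset G) : difR X 1 = #X := by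
  simp [difR]

/-- Double counting: `Σ_δ difR X δ = #X²` (every pair `(x, x')` is counted once, at `δ = x'⁻¹x`). [folklore] -/
theorem sum_difR [Fintype G] (X : Finset G) : ∑ δ, difR X δ = #X * #X := by
  simp only [difR, card_filter]
  rw [sum_comm]
  have : ∀ x ∈ X, (∑ δ : G, if x * δ⁻¹ ∈ X then 1 else 0) = #X := by
    intro x _
    rw [← card_filter]
    have : (univ.filter fun δ : G => x * δ⁻¹ ∈ X) = X.image (fun x' => x'⁻¹ * x) := by
      ext δ
      simp only [mem_filter, mem_univ, true_and, mem_image]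
      constructor
      · intro h; exact ⟨x * δ⁻¹, h, by group⟩
      · rintro ⟨x', hx', rfl⟩; simpa using hx'
    rw [this, card_image_of_injective _ fun a b (e : a⁻¹ * x = b⁻¹ * x) => by simpa using e]
  rw [sum_congr rfl this, sum_const, smul_eq_mul]

/-- A positive right count exhibits the quotient: `0 < difR X δ ⇒ δ = x'⁻¹x` with `x, x' ∈ X`. [folklore] -/
theorem exists_eq_inv_mul_of_difR_pos {X : Finset G} {δ : G} (h : 0 < difR X δ) :
    ∃ x ∈ X, ∃ x' ∈ X, δ = x'⁻¹ * x := by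
  obtain ⟨x, hx⟩ := card_pos.1 h
  rw [mem_filter] at hx
  exact ⟨x, hx.1, x * δ⁻¹, hx.2, by group⟩

/-- A positive left count exhibits the quotient: `0 < difL Y g ⇒ g = y·y'⁻¹` with `y, y' ∈ Y`. [folklore] -/
theorem exists_eq_mul_inv_of_difL_pos {Y : Finset G} {g : G} (h : 0 < difL Y g) :
    ∃ y ∈ Y, ∃ y' ∈ Y, g = y * y'⁻¹ := by
  obtain ⟨y, hy⟩ := card_pos.1 h
  rw [mem_filter] at hy
  exact ⟨y, hy.1, g⁻¹ * y, hy.2, by group⟩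

/-- Double counting of factorisations: `Σ_g repMul X Y g = #X·#Y`. [folklore] -/
theorem sum_repMul [Fintype G] (X Y : Finset G) : ∑ g, repMul X Y g = #X * #Y := by
  simp only [repMul, card_filter]
  rw [sum_comm]
  have : ∀ x ∈ X, (∑ g : G, if x⁻¹ * g ∈ Y then 1 else 0) = #Y := by
    intro x _
    rw [← card_filter]
    have : (univ.filter fun g : G => x⁻¹ * g ∈ Y) = Y.image (fun y => x * y) := by
      ext g
      simp only [mem_filter, mem_univ, true_and, mem_image]
      constructor
      · intro h; exact ⟨x⁻¹ * g, h, by group⟩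
      · rintro ⟨y, hy, rfl⟩; simpa using hy
    rw [this, card_image_of_injective _ (mul_right_injective x)]
  rw [sum_congr rfl this, sum_const, smul_eq_mul]

/-- `repMul X Y g ≤ #X`. [folklore] -/
theorem repMul_le_left (X Y : Finset G) (g : G) : repMul X Y g ≤ #X := card_filter_le _ _

/-- A positive factorisation count exhibits the factorisation. [folklore] -/
theorem exists_eq_mul_of_repMul_pos {X Y : Finset G} {g : G} (h : 0 < repMul X Y g) :
    ∃ x ∈ X, ∃ y ∈ Y, g = x * y := by
  obtain ⟨x, hx⟩ := card_pos.1 h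
  rw [mem_filter] at hx
  exact ⟨x, hx.1, x⁻¹ * g, hx.2, by group⟩

/-- If all products `x·y` lie in `P`, the factorisation count vanishes off `P`. [folklore] -/
theorem repMul_eq_zero_of_not_mem {X Y P : Finset G} (hP : ∀ x ∈ X, ∀ y ∈ Y, x * y ∈ P) {g : G} (hg : g ∉ P) :
    repMul X Y g = 0 := by
  rw [repMul, card_eq_zero, filter_eq_empty_iff]
  intro x hx hy
  exact hg (by simpa using hP x hx (x⁻¹ * g) hy)

/-! ## §2 Abstract multiplicative combinatorics: near-periods from translate counts, closure, the bound -/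

section Abstract

variable [Fintype G] {X Y Z : Finset G} {m : ℕ}

omit [Group G] in
/-- **Inclusion–exclusion of two translates.**  If `S, S' ⊆ G` have `#S = #S' = m` and each meets `Z` (`#Z = m`) in at most two
points, then `3m ≤ #(S ∩ S') + |G| + 4` (both sit inside `G ∖ Z`, of size `|G| − m`, up to two points each). [folklore] -/
theorem three_mul_le_card_inter_add {S S' : Finset G} (hS : #S = m) (hS' : #S' = m) (hZ : #Z = m)
    (h2 : #(S ∩ Z) ≤ 2) (h2' : #(S' ∩ Z) ≤ 2) : 3 * m ≤ #(S ∩ S') + Fintype.card G + 4 := by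
  have hd : Disjoint (S \ Z ∪ S' \ Z) Z := by
    rw [disjoint_left]
    intro g hg hgZ
    rcases mem_union.1 hg with hg | hg <;> exact (mem_sdiff.1 hg).2 hgZ
  have hUZ : #(S \ Z ∪ S' \ Z) + #Z ≤ Fintype.card G := by
    rw [← card_union_of_disjoint hd]; exact card_le_univ _
  have hIE := card_union_add_card_inter (S \ Z) (S' \ Z)
  have hsub : #((S \ Z) ∩ (S' \ Z)) ≤ #(S ∩ S') :=
    card_le_card fun g hg => by
      rw [mem_inter] at hg ⊢
      exact ⟨(mem_sdiff.1 hg.1).1, (mem_sdiff.1 hg.2).1⟩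
  have h1 := card_sdiff_add_card_inter S Z
  have h1' := card_sdiff_add_card_inter S' Z
  omega

/-- **Right near-periods from the column count.**  If `#X = #Z = m` and every right translate `X·y` (`y ∈ Y`) meets `Z` in at most
two points, then for `y, y' ∈ Y`: `difR X (y'·y⁻¹) = |X·y ∩ X·y'| ≥ 3m − |G| − 4`. [folklore] -/
theorem le_difR_of_translate (hX : #X = m) (hZ : #Z = m)
    (hcol : ∀ y ∈ Y, #(X.filter fun x => x * y ∈ Z) ≤ 2) {y y' : G} (hy : y ∈ Y) (hy' : y' ∈ Y) :
    3 * m ≤ difR X (y' * y⁻¹) + Fintype.card G + 4 := by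
  set S := X.image fun x => x * y with hS
  set S' := X.image fun x => x * y' with hS'
  have hSm : #S = m := by rw [hS, card_image_of_injective _ (mul_left_injective y), hX]
  have hS'm : #S' = m := by rw [hS', card_image_of_injective _ (mul_left_injective y'), hX]
  have hSZ : ∀ {w : G}, w ∈ Y → #(X.image (fun x => x * w) ∩ Z) ≤ 2 := by
    intro w hw
    have : X.image (fun x => x * w) ∩ Z = (X.filter fun x => x * w ∈ Z).image (fun x => x * w) := by
      ext g
      simp only [mem_inter, mem_image, mem_filter]
      constructor
      · rintro ⟨⟨x, hx, rfl⟩, hg⟩; exact ⟨x, ⟨hx, hg⟩, rfl⟩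
      · rintro ⟨x, ⟨hx, hg⟩, rfl⟩; exact ⟨⟨x, hx, rfl⟩, hg⟩
    rw [this]
    exact card_image_le.trans (hcol w hw)
  have hint : #(S ∩ S') = difR X (y' * y⁻¹) := by
    rw [difR, ← card_image_of_injective (X.filter fun x => x * (y' * y⁻¹)⁻¹ ∈ X) (mul_left_injective y)]
    congr 1
    ext g
    simp only [mem_inter, mem_image, mem_filter, hS, hS']
    constructor
    · rintro ⟨⟨x, hx, rfl⟩, ⟨x', hx', he⟩⟩
      refine ⟨x, ⟨hx, ?_⟩, rfl⟩
      have e : x * (y' * y⁻¹)⁻¹ = x' := by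
        rw [mul_inv_rev, inv_inv, ← mul_assoc, ← he, mul_inv_cancel_right]
      rw [e]; exact hx'
    · rintro ⟨x, ⟨hx, hx'⟩, rfl⟩
      refine ⟨⟨x, hx, rfl⟩, ⟨x * (y' * y⁻¹)⁻¹, hx', ?_⟩⟩
      rw [mul_inv_rev, inv_inv]; group
  have := three_mul_le_card_inter_add hSm hS'm hZ (hSZ hy) (hSZ hy')
  omega

/-- **Left near-periods from the row count.**  If `#Y = #Z = m` and every left translate `x·Y` (`x ∈ X`) meets `Z` in at most two
points, then for `x, x' ∈ X`: `difL Y (x⁻¹·x') = |x·Y ∩ x'·Y| ≥ 3m − |G| − 4`. [folklore] -/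
theorem le_difL_of_translate (hY : #Y = m) (hZ : #Z = m)
    (hrow : ∀ x ∈ X, #(Y.filter fun y => x * y ∈ Z) ≤ 2) {x x' : G} (hx : x ∈ X) (hx' : x' ∈ X) :
    3 * m ≤ difL Y (x⁻¹ * x') + Fintype.card G + 4 := by
  set S := Y.image fun y => x * y with hS
  set S' := Y.image fun y => x' * y with hS'
  have hSm : #S = m := by rw [hS, card_image_of_injective _ (mul_right_injective x), hY]
  have hS'm : #S' = m := by rw [hS', card_image_of_injective _ (mul_right_injective x'), hY]
  have hSZ : ∀ {w : G}, w ∈ X → #(Y.image (fun y => w * y) ∩ Z) ≤ 2 := by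
    intro w hw
    have : Y.image (fun y => w * y) ∩ Z = (Y.filter fun y => w * y ∈ Z).image (fun y => w * y) := by
      ext g
      simp only [mem_inter, mem_image, mem_filter]
      constructor
      · rintro ⟨⟨y, hy, rfl⟩, hg⟩; exact ⟨y, ⟨hy, hg⟩, rfl⟩
      · rintro ⟨y, ⟨hy, hg⟩, rfl⟩; exact ⟨⟨y, hy, rfl⟩, hg⟩
    rw [this]
    exact card_image_le.trans (hrow w hw)
  have hint : #(S ∩ S') = difL Y (x⁻¹ * x') := by
    rw [difL, ← card_image_of_injective (Y.filter fun y => (x⁻¹ * x')⁻¹ * y ∈ Y) (mul_right_injective x)]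
    congr 1
    ext g
    simp only [mem_inter, mem_image, mem_filter, hS, hS']
    constructor
    · rintro ⟨⟨y, hy, rfl⟩, ⟨y', hy', he⟩⟩
      refine ⟨y, ⟨hy, ?_⟩, rfl⟩
      have e : (x⁻¹ * x')⁻¹ * y = y' := by
        rw [mul_inv_rev, inv_inv, mul_assoc, ← he, inv_mul_cancel_left]
      rw [e]; exact hy'
    · rintro ⟨y, ⟨hy, hy'⟩, rfl⟩
      exact ⟨⟨y, hy, rfl⟩, ⟨(x⁻¹ * x')⁻¹ * y, hy', by group⟩⟩
  have := three_mul_le_card_inter_add hSm hS'm hZ (hSZ hx) (hSZ hx')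
  omega

omit [Fintype G] in
/-- **Closure by pigeonhole.**  If `#X = m` and both `2·difR X δ₁ > m` and `2·difR X δ₂⁻¹ > m`, then `δ₁·δ₂ ∈ X⁻¹X` with a
positive count: some `x ∈ X` has `x·δ₁⁻¹ ∈ X` and `x·δ₂ ∈ X`, and `δ₁δ₂ = (xδ₁⁻¹)⁻¹(xδ₂)`.
(The device behind Freiman's `3/2`-theorem.) [folklore] -/
theorem difR_mul_pos_of_lt (hX : #X = m) {δ₁ δ₂ : G} (h1 : m < 2 * difR X δ₁) (h2 : m < 2 * difR X δ₂⁻¹) :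
    0 < difR X (δ₁ * δ₂) := by
  set P := X.filter fun x => x * δ₁⁻¹ ∈ X with hP
  set Q := X.filter fun x => x * δ₂⁻¹⁻¹ ∈ X with hQ
  have hPc : difR X δ₁ = #P := rfl
  have hQc : difR X δ₂⁻¹ = #Q := rfl
  have hPQ : (P ∩ Q).Nonempty := by
    rw [← card_pos]
    have hu : #(P ∪ Q) ≤ m := hX ▸ card_le_card (union_subset (filter_subset _ _) (filter_subset _ _))
    have := card_union_add_card_inter P Q
    omega
  obtain ⟨x, hx⟩ := hPQ
  rw [mem_inter, hP, hQ, mem_filter, mem_filter, inv_inv] at hx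
  apply card_pos.2
  refine ⟨x * δ₂, mem_filter.2 ⟨hx.2.2, ?_⟩⟩
  have e : x * δ₂ * (δ₁ * δ₂)⁻¹ = x * δ₁⁻¹ := by group
  rw [e]; exact hx.1.2

/-- **The abstract density bound in any finite group.**  `X, Y, Z ⊆ G` of size `m ≥ 4` with: exactly two factorisations
`z = x·y` of every `z ∈ Z`; every right translate `X·y` (`y ∈ Y`) and every left translate `x·Y` (`x ∈ X`) meeting `Z` in at most
two points.  Then `5m ≤ 2|G| + 8`.  (Near-periods, closure of `X⁻¹X` by pigeonhole, mass and energy counts; see the file header.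
No commutativity, no Kneser.) [folklore] -/
theorem five_mul_le_two_mul_card_add_group (hX : #X = m) (hY : #Y = m) (hZ : #Z = m) (hm : 4 ≤ m)
    (hrep : ∀ z ∈ Z, repMul X Y z = 2)
    (hcol : ∀ y ∈ Y, #(X.filter fun x => x * y ∈ Z) ≤ 2)
    (hrow : ∀ x ∈ X, #(Y.filter fun y => x * y ∈ Z) ≤ 2) :
    5 * m ≤ 2 * Fintype.card G + 8 := by
  by_contra hlt
  push Not at hlt
  set n := Fintype.card G with hn
  have hXne : X.Nonempty := card_pos.1 (by omega)
  have hYne : Y.Nonempty := card_pos.1 (by omega)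
  -- the near-period margin `σ = 3m − n − 4`, with `2σ ≥ m + 1`
  have hmn : m ≤ n := hX ▸ card_le_univ X
  obtain ⟨σ, hσ⟩ : ∃ σ, 3 * m = σ + n + 4 := ⟨3 * m - (n + 4), by omega⟩
  have h2σ : m + 1 ≤ 2 * σ := by omega
  -- near-periods: right for `Y Y⁻¹` on `X`, left for `X⁻¹ X` on `Y`
  have hNPX : ∀ y ∈ Y, ∀ y' ∈ Y, σ ≤ difR X (y' * y⁻¹) := by
    intro y hy y' hy'
    have := le_difR_of_translate hX hZ hcol hy hy'
    omega
  have hNPY : ∀ x ∈ X, ∀ x' ∈ X, σ ≤ difL Y (x⁻¹ * x') := by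
    intro x hx x' hx'
    have := le_difL_of_translate hY hZ hrow hx hx'
    omega
  -- `D = X⁻¹ X`
  set D := (X ×ˢ X).image (fun p : G × G => p.1⁻¹ * p.2) with hD
  have hmemD : ∀ {δ : G}, δ ∈ D ↔ ∃ x ∈ X, ∃ x' ∈ X, δ = x⁻¹ * x' := by
    intro δ
    simp only [hD, mem_image, mem_product, Prod.exists]
    constructor
    · rintro ⟨x, x', ⟨hx, hx'⟩, rfl⟩; exact ⟨x, hx, x', hx', rfl⟩
    · rintro ⟨x, hx, x', hx', rfl⟩; exact ⟨x, x', ⟨hx, hx'⟩, rfl⟩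
  -- every element of `Y Y⁻¹` lies in `D` (a near-period with `σ ≥ 1` is a quotient)
  have hYYD : ∀ y ∈ Y, ∀ y' ∈ Y, y' * y⁻¹ ∈ D := by
    intro y hy y' hy'
    obtain ⟨x, hx, x', hx', he⟩ := exists_eq_inv_mul_of_difR_pos (X := X) (δ := y' * y⁻¹) (by
      have := hNPX y hy y' hy'; omega)
    exact hmemD.2 ⟨x', hx', x, hx, he⟩
  -- every element of `D` is a near-period of `X`
  have hDσ : ∀ δ ∈ D, σ ≤ difR X δ := by
    intro δ hδ
    obtain ⟨x, hx, x', hx', rfl⟩ := hmemD.1 hδ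
    obtain ⟨y, hy, y', hy', he⟩ := exists_eq_mul_inv_of_difL_pos (Y := Y) (g := x⁻¹ * x') (by
      have := hNPY x hx x' hx'; omega)
    rw [he]
    exact hNPX y' hy' y hy
  have hDinv : ∀ δ ∈ D, δ⁻¹ ∈ D := by
    intro δ hδ
    obtain ⟨x, hx, x', hx', rfl⟩ := hmemD.1 hδ
    exact hmemD.2 ⟨x', hx', x, hx, by group⟩
  -- closure: `D·D ⊆ D`
  have hDmul : ∀ δ₁ ∈ D, ∀ δ₂ ∈ D, δ₁ * δ₂ ∈ D := by
    intro δ₁ h₁ δ₂ h₂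
    have hpos := difR_mul_pos_of_lt hX (δ₁ := δ₁) (δ₂ := δ₂)
      (by have := hDσ δ₁ h₁; omega) (by have := hDσ δ₂⁻¹ (hDinv δ₂ h₂); omega)
    obtain ⟨x, hx, x', hx', he⟩ := exists_eq_inv_mul_of_difR_pos hpos
    exact hmemD.2 ⟨x', hx', x, hx, he⟩
  -- `X·Y ⊆ P := x₀·D·y₀`, `#P = #D`
  obtain ⟨x₀, hx₀⟩ := hXne
  obtain ⟨y₀, hy₀⟩ := hYne
  set P := D.image (fun d => x₀ * d * y₀) with hPdef
  have hPD : #P = #D := by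
    rw [hPdef]
    exact card_image_of_injective _ fun d d' (e : x₀ * d * y₀ = x₀ * d' * y₀) => by simpa using e
  have hXYP : ∀ x ∈ X, ∀ y ∈ Y, x * y ∈ P := by
    intro x hx y hy
    have h1 : x₀⁻¹ * x ∈ D := hmemD.2 ⟨x₀, hx₀, x, hx, rfl⟩
    have h2 : y * y₀⁻¹ ∈ D := hYYD y₀ hy₀ y hy
    refine mem_image.2 ⟨x₀⁻¹ * x * (y * y₀⁻¹), hDmul _ h1 _ h2, by group⟩
  -- `Z ⊆ P`
  have hZP : Z ⊆ P := fun z hz => by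
    obtain ⟨x, hx, y, hy, rfl⟩ := exists_eq_mul_of_repMul_pos (X := X) (Y := Y) (g := z) (by rw [hrep z hz]; norm_num)
    exact hXYP x hx y hy
  -- mass count: `m² = Σ_{g ∈ P} repMul ≤ 2m + (#P − m)·m`
  have hmass : m * m ≤ 2 * m + (#D - m) * m := by
    have htot : ∑ g, repMul X Y g = m * m := by rw [sum_repMul, hX, hY]
    have hsplit : ∑ g, repMul X Y g = ∑ g ∈ P, repMul X Y g := by
      rw [← sum_subset (subset_univ P)]
      intro g _ hg
      exact repMul_eq_zero_of_not_mem hXYP hg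
    have hPZ : ∑ g ∈ P, repMul X Y g = ∑ g ∈ Z, repMul X Y g + ∑ g ∈ P \ Z, repMul X Y g := by
      rw [← sum_sdiff hZP, add_comm]
    have hZsum : ∑ g ∈ Z, repMul X Y g = 2 * m := by
      rw [sum_congr rfl hrep, sum_const, smul_eq_mul, hZ, mul_comm]
    have hrest : ∑ g ∈ P \ Z, repMul X Y g ≤ (#D - m) * m := by
      calc ∑ g ∈ P \ Z, repMul X Y g ≤ ∑ g ∈ P \ Z, m := sum_le_sum fun g _ => hX ▸ repMul_le_left X Y g
        _ = #(P \ Z) * m := by rw [sum_const, smul_eq_mul]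
        _ = (#D - m) * m := by rw [card_sdiff_of_subset hZP, hPD, hZ]
    rw [htot, hPZ, hZsum] at hsplit
    omega
  have hmD : m ≤ #D := by
    have := card_le_card hZP; rw [hZ, hPD] at this; exact this
  have hDge : 2 * m ≤ #D + 2 := by
    have h1 : m * m ≤ (2 + (#D - m)) * m := by nlinarith
    have h2 : m ≤ 2 + (#D - m) := Nat.le_of_mul_le_mul_right h1 (by omega)
    omega
  -- energy: `Σ_{δ ∈ D ∖ 1} difR X δ ≤ m² − m`, each term `≥ σ`
  have h1D : (1 : G) ∈ D := hmemD.2 ⟨x₀, hx₀, x₀, hx₀, by group⟩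
  have henergy : (#D - 1) * σ + m ≤ m * m := by
    have hle : ∑ δ ∈ D, difR X δ ≤ m * m := by
      calc ∑ δ ∈ D, difR X δ ≤ ∑ δ, difR X δ :=
            sum_le_sum_of_subset_of_nonneg (subset_univ D) fun _ _ _ => Nat.zero_le _
        _ = m * m := by rw [sum_difR, hX]
    have hsplit : ∑ δ ∈ D, difR X δ = difR X 1 + ∑ δ ∈ D.erase 1, difR X δ := (add_sum_erase D _ h1D).symm
    have hlow : (#D - 1) * σ ≤ ∑ δ ∈ D.erase 1, difR X δ := by
      calc (#D - 1) * σ = ∑ δ ∈ D.erase 1, σ := by rw [sum_const, smul_eq_mul, card_erase_of_mem h1D]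
        _ ≤ ∑ δ ∈ D.erase 1, difR X δ := sum_le_sum fun δ hδ => hDσ δ (mem_of_mem_erase hδ)
    rw [difR_one, hX] at hsplit
    omega
  -- arithmetic: `2m(m + 1) ≤ (#D + 2)(m + 1) ≤ 2(#D − 1)σ + 3(m + 1) ≤ 2m² + m + 3` forces `m ≤ 3`
  obtain ⟨e, he⟩ : ∃ e, #D = e + 1 := ⟨#D - 1, by omega⟩
  rw [he, Nat.add_sub_cancel] at henergy
  have h3 : 2 * m ≤ e + 3 := by omega
  have hA : 2 * m * (m + 1) ≤ (e + 3) * (m + 1) := Nat.mul_le_mul_right _ h3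
  have hB : e * (m + 1) ≤ e * (2 * σ) := Nat.mul_le_mul_left _ h2σ
  nlinarith [hA, hB, henergy, hm]

end Abstract

end Summit.MatrixMultiplication.OmegaCensus.CubeNB
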